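import Mathlib
import HarnessLib

/-!
# Resampling one site of a finite product measure

HONEST FRAMING: exact (Metropolis-corrected) sampling algorithms for lattice gauge theory;
figures of merit are autocorrelation/cost numbers at stated couplings and volumes; no
continuum-physics claim.

Venture `LatticeQCDFlow` (cell pub-lqcd), topic `Exactness`; FANOUT row 7 (`s0-cpn-null`).  NEW
WORK of the cell over Mathlib (`Measure.pi_eq`, `Measure.prod_prod`, `integral_prod`); nothing is
cited as a fact.  A bookkeeping file for the lattice Green identity of Lüscher's operator
`−Σ_k ∂̃_k·∂̃_k` on a product of site spheres (`Exactness/SphereLatticeGreen.lean`): integrating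
over a finite product `⊗_i μ_i` may be done by first redrawing ONE coordinate from its own law.

## Content (`ι` finite, measurable spaces `α i`, σ-finite `μ i`, a site `k` with `μ_k` finite and
## nonzero)

* `update_preimage_univ_pi` — the preimage of a box under the resampling map
  `(ω, v) ↦ ω[k ← v]` is a box times the `k`-th side.
* **`pi_eq_map_update`** — `⊗_i μ_i` is the push-forward of `(⊗_i μ_i) ⊗ (μ_k/μ_k(univ))` under
  `(ω, v) ↦ ω[k ← v]` (the coordinate `ω_k` is forgotten and redrawn).
* **`integral_pi_eq_integral_integral_update`** — for `h` integrable,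
  `μ_k(univ) • ∫ h d(⊗μ) = ∫ (∫ h(ω[k ← v]) dμ_k(v)) d(⊗μ)(ω)`;
  `integral_pi_eq_integral_integral_update'` — the same solved for `∫ h`.

NOT CLAIMED: anything beyond this Fubini-type bookkeeping (Mathlib's `lmarginal` covers the
`ℝ≥0∞`-valued case; this is the signed/Bochner form the Green identity needs).
-/

noncomputable section

namespace Summit.Ventures.LatticeQCDFlow.Exactness

open MeasureTheory Set Function
open scoped ENNReal

variable {ι : Type*} [Fintype ι] [DecidableEq ι] {α : ι → Type*} [∀ i, MeasurableSpace (α i)]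

omit [Fintype ι] [∀ i, MeasurableSpace (α i)] in
/-- **The preimage of a box under resampling site `k`**: `{(ω, v) | ω[k ← v] ∈ Π_i s_i}` is
`(Π_i s'_i) × s_k` with `s' = s[k ← univ]`. -/
theorem update_preimage_univ_pi (k : ι) (s : ∀ i, Set (α i)) :
    (fun p : (∀ i, α i) × α k => update p.1 k p.2) ⁻¹' (univ.pi s) =
      (univ.pi (update s k univ)) ×ˢ s k := by
  ext ⟨ω, v⟩
  simp only [mem_preimage, mem_univ_pi, mem_prod]
  constructor
  · intro h
    refine ⟨fun i => ?_, by simpa using h k⟩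
    by_cases hi : i = k
    · subst hi; simp
    · simpa [update_of_ne hi] using h i
  · rintro ⟨h1, h2⟩ i
    by_cases hi : i = k
    · subst hi; simpa using h2
    · simpa [update_of_ne hi] using h1 i

variable (μ : ∀ i, Measure (α i))

/-- Product bookkeeping: `(∏_i μ_i(s[k ← univ]_i)) · μ_k(s_k) = μ_k(univ) · ∏_i μ_i(s_i)`. -/
theorem prod_measure_update_univ_mul (k : ι) (s : ∀ i, Set (α i)) :
    (∏ i, μ i (update s k univ i)) * μ k (s k) = μ k univ * ∏ i, μ i (s i) := by
  have h1 : ∀ i, μ i (update s k univ i) = update (fun i => μ i (s i)) k (μ k univ) i := by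
    intro i
    by_cases hi : i = k
    · subst hi; simp
    · simp [update_of_ne hi]
  rw [Finset.prod_congr rfl fun i _ => h1 i, Finset.prod_update_of_mem (Finset.mem_univ k),
    ← Finset.prod_erase_mul (Finset.univ : Finset ι) (fun i => μ i (s i)) (Finset.mem_univ k),
    Finset.sdiff_singleton_eq_erase]
  ring

variable [∀ i, SigmaFinite (μ i)]

/-- **Resampling one site.**  For a finite nonzero `μ_k`, the product measure `⊗_i μ_i` is the
push-forward of `(⊗_i μ_i) ⊗ (μ_k(univ)⁻¹ • μ_k)` under `(ω, v) ↦ ω[k ← v]`: forgetting the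
`k`-th coordinate and redrawing it from its own (normalised) law changes nothing. -/
theorem pi_eq_map_update (k : ι) [IsFiniteMeasure (μ k)] (hk : μ k univ ≠ 0) :
    Measure.pi μ = Measure.map (fun p : (∀ i, α i) × α k => update p.1 k p.2)
      ((Measure.pi μ).prod ((μ k univ)⁻¹ • μ k)) := by
  refine Measure.pi_eq fun s hs => ?_
  rw [Measure.map_apply measurable_update' (MeasurableSet.univ_pi hs), update_preimage_univ_pi,
    Measure.prod_prod, Measure.pi_pi, Measure.smul_apply, smul_eq_mul]
  have hfin : μ k univ ≠ ∞ := measure_ne_top _ _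
  calc (∏ i, μ i (update s k univ i)) * ((μ k univ)⁻¹ * μ k (s k))
      = (μ k univ)⁻¹ * ((∏ i, μ i (update s k univ i)) * μ k (s k)) := by ring
    _ = (μ k univ)⁻¹ * (μ k univ * ∏ i, μ i (s i)) := by rw [prod_measure_update_univ_mul]
    _ = ∏ i, μ i (s i) := by rw [← mul_assoc, ENNReal.inv_mul_cancel hk hfin, one_mul]

variable {F : Type*} [NormedAddCommGroup F] [NormedSpace ℝ F]

/-- **Integrating over a product by first redrawing one site** (Fubini through
`pi_eq_map_update`): for `h` integrable w.r.t. `⊗_i μ_i` and `μ_k` finite nonzero,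
`∫ h d(⊗μ) = μ_k(univ)⁻¹ • ∫ (∫ h(ω[k ← v]) dμ_k(v)) d(⊗μ)(ω)`. -/
theorem integral_pi_eq_integral_integral_update' (k : ι) [IsFiniteMeasure (μ k)]
    (hk : μ k univ ≠ 0) {h : (∀ i, α i) → F} (hh : Integrable h (Measure.pi μ)) :
    ∫ ω, h ω ∂Measure.pi μ =
      ((μ k univ)⁻¹).toReal • ∫ ω, ∫ v, h (update ω k v) ∂μ k ∂Measure.pi μ := by
  have hU : Measurable (fun p : (∀ i, α i) × α k => update p.1 k p.2) := measurable_update'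
  have hpi := pi_eq_map_update μ k hk
  have hsm : AEStronglyMeasurable h (Measure.map (fun p : (∀ i, α i) × α k => update p.1 k p.2)
      ((Measure.pi μ).prod ((μ k univ)⁻¹ • μ k))) := by
    rw [← hpi]; exact hh.aestronglyMeasurable
  have hint : Integrable (fun p : (∀ i, α i) × α k => h (update p.1 k p.2))
      ((Measure.pi μ).prod ((μ k univ)⁻¹ • μ k)) := by
    have hh' : Integrable h (Measure.map (fun p : (∀ i, α i) × α k => update p.1 k p.2)
        ((Measure.pi μ).prod ((μ k univ)⁻¹ • μ k))) := by rw [← hpi]; exact hh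
    exact (integrable_map_measure hsm hU.aemeasurable).1 hh'
  calc ∫ ω, h ω ∂Measure.pi μ
      = ∫ ω, h ω ∂Measure.map (fun p : (∀ i, α i) × α k => update p.1 k p.2)
          ((Measure.pi μ).prod ((μ k univ)⁻¹ • μ k)) := by rw [← hpi]
    _ = ∫ p, h (update p.1 k p.2) ∂(Measure.pi μ).prod ((μ k univ)⁻¹ • μ k) :=
        integral_map hU.aemeasurable hsm
    _ = ∫ ω, ∫ v, h (update ω k v) ∂((μ k univ)⁻¹ • μ k) ∂Measure.pi μ := integral_prod _ hint
    _ = ∫ ω, ((μ k univ)⁻¹).toReal • ∫ v, h (update ω k v) ∂μ k ∂Measure.pi μ := by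
        simp_rw [integral_smul_measure]
    _ = ((μ k univ)⁻¹).toReal • ∫ ω, ∫ v, h (update ω k v) ∂μ k ∂Measure.pi μ :=
        integral_smul _ _

/-- **Integrating over a product by first redrawing one site**, multiplied through:
`μ_k(univ) • ∫ h d(⊗μ) = ∫ (∫ h(ω[k ← v]) dμ_k(v)) d(⊗μ)(ω)`. -/
theorem integral_pi_eq_integral_integral_update (k : ι) [IsFiniteMeasure (μ k)]
    (hk : μ k univ ≠ 0) {h : (∀ i, α i) → F} (hh : Integrable h (Measure.pi μ)) :
    (μ k univ).toReal • ∫ ω, h ω ∂Measure.pi μ =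
      ∫ ω, ∫ v, h (update ω k v) ∂μ k ∂Measure.pi μ := by
  have hfin : μ k univ ≠ ∞ := measure_ne_top _ _
  rw [integral_pi_eq_integral_integral_update' μ k hk hh, smul_smul, ENNReal.toReal_inv,
    mul_inv_cancel₀ (ENNReal.toReal_ne_zero.2 ⟨hk, hfin⟩), one_smul]

omit [Fintype ι] [∀ i, SigmaFinite (μ i)] in
/-- The inner resampling integral does not depend on the resampled coordinate:
`∫ h(ω[k ← v]) dμ_k(v)` is the same for `ω` and `ω[k ← w]`. -/
theorem integral_update_update (k : ι) (h : (∀ i, α i) → F) (ω : ∀ i, α i) (w : α k) :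
    ∫ v, h (update (update ω k w) k v) ∂μ k = ∫ v, h (update ω k v) ∂μ k := by
  simp only [update_idem]

end Summit.Ventures.LatticeQCDFlow.Exactness

end
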